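import Summits.CriticalPhenomena.Ising3DConformalLimit.Theses.PerfectScreening
import Summits.CriticalPhenomena.Ising3DConformalLimit.Theses.PrecisionLaplacian
import Summits.CriticalPhenomena.Ising3DConformalLimit.Theorems.PrecisionLaplacianInverseMCriticalKernel
import Literature.Probability.LatticeModels.PointwiseScalingLimitEtaExists
import Literature.Probability.LatticeModels.CriticalTwoPointLower
import Literature.Probability.LatticeModels.HighDimPointwiseTriviality
import Literature.Probability.LatticeModels.LatticeLaplacianZd
import Summits.CriticalPhenomena.Ising3DConformalLimit.Theorems.PerfectScreeningSubharmonicOffOriginStubUnitRate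

/-!
# The FIRST SHELL of `SubharmonicOffOrigin` from the inverse-M conjecture (crux stmt-CriticalPhenomena-1341,
line `direct-correlation-shells`; lead `prover-line-stmt-CriticalPhenomena-1341-0`)

Lands the PROVED part of the planner's checked skeleton `Cruxes/SubharmonicOffOrigin/Lines/direct_correlation_shells.lean`
(rev 3) under a Theorems namespace: objects `nbrSum`, `dcf` (canonical direct-correlation function
`a(y) = inf_{A ∋ 0,y} −(G_A⁻¹)(0,y)`, item 4803), `IsSymmetricPotential` (conclusion of item 4802), `KernelForm`
(conclusion of item 4803); the long-jump balance `Σ_y a(y)[G(x) − G(x−y)] = 0` for `x ≠ 0` (`hasSum_balance`), the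
hyperoctahedral symmetry of `dcf` (`dcf_equivariant`, `dcf_single`, `dcf_neg`), the card identity L0
`longJump_identity`, and the FIRST SHELL `firstShell`: kernel form + `a₁ > 0` ⇒ `6·G(x) ≤ Σ_nbrs G` at `x = ±eᵢ`
term by term (Messager–Miracle-Solé maximality `G(z) ≤ G(e₀)`, `z ≠ 0`).  Registered export (sub-goal
`subH_unitSteps_of_IM`): `InverseMFerromagnet → PrecisionIsLaplacian → (InverseMFerromagnet → 0 < dcf e₀) →`
SubH at `±eᵢ`; and with the third hypothesis DISCHARGED by the landed stub `DcsUnitRate.stub_unitRate` (p103091):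
`subH_unitSteps_of_IM_of_PIL` — SubH at the six unit sites CONDITIONAL on items 4798 (open) and 4803 (open)
only (maximality `unitRate_G_le_G_e0` is also taken from that module; reviewer q3058646 revise honoured).
-/
noncomputable section

open Filter Topology
open Literature.Probability.LatticeModels

namespace Summit.CriticalPhenomena.Ising3DConformalLimit.Theorems.PerfectScreening.Dcs

open Summit.CriticalPhenomena.Ising3DConformalLimit.Theorems.PerfectScreening.DcsUnitRate
  (unitRate_one_le_supNorm unitRate_G_le_G_e0 stub_unitRate)

/-- `G = ⟨σ₀σ_x⟩⁺_{β_c(3)}` on `ℤ³` (notation, purely syntactic). -/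
local notation "G" => Literature.Probability.LatticeModels.criticalTwoPoint 3

/-- The neighbour sum `N(x) = Σᵢ (G(x+eᵢ) + G(x−eᵢ))`; the crux is `6·G(x) ≤ N(x)` for `x ≠ 0`. -/
def nbrSum (x : Site 3) : ℝ := ∑ i : Fin 3, (G (x + Pi.single i 1) + G (x - Pi.single i 1))

/-- The CANONICAL DIRECT-CORRELATION FUNCTION (precision kernel) of the critical state, verbatim the
function of item 4803 `PrecisionIsLaplacian`: `dcf y = inf_{A ∋ 0, y} −(G_A⁻¹)(0, y)` over finite
`A ⊂ ℤ³` (`= a(y) ≥ 0` for `y ≠ 0` and `= −A₀ < 0` at `y = 0`, under IM). -/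
def dcf (y : Site 3) : ℝ :=
  ⨅ A : {A : Finset (Site 3) // (0 : Site 3) ∈ A ∧ y ∈ A},
    -((Matrix.of fun (p q : ↥A.1) => criticalTwoPoint 3 (q.1 - p.1))⁻¹ ⟨0, A.2.1⟩ ⟨y, A.2.2⟩)

/-- The symmetric-potential property of the critical kernel (conclusion of item 4802
`InverseMCriticalKernel`, hypothesis of 4803 / 4799), verbatim. -/
def IsSymmetricPotential : Prop :=
  ∀ A : Finset (Site 3), (Matrix.of fun (p q : ↥A) => criticalTwoPoint 3 (q.1 - p.1)).PosDef ∧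
    ∀ u v : ↥A, (u ≠ v → (Matrix.of fun (p q : ↥A) => criticalTwoPoint 3 (q.1 - p.1))⁻¹ u v ≤ 0) ∧
      0 ≤ ∑ w, (Matrix.of fun (p q : ↥A) => criticalTwoPoint 3 (q.1 - p.1))⁻¹ u w

/-- The KERNEL FORM delivered by item 4803 `PrecisionIsLaplacian`, written with `dcf`: summable, total
mass `0`, nonnegative off `0`, negative at `0`, and minus the convolution inverse of `G`. -/
def KernelForm : Prop :=
  Summable dcf ∧ (∑' y, dcf y) = 0 ∧ (∀ y : Site 3, y ≠ 0 → 0 ≤ dcf y) ∧ dcf 0 < 0 ∧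
    ∀ z : Site 3, (∑' y, dcf y * G (z - y)) = if z = 0 then -1 else 0

/-- Transcription check: item 4802 is literally `IM → IsSymmetricPotential`. -/
theorem inverseMCriticalKernel_iff :
    Summit.CriticalPhenomena.Ising3DConformalLimit.Theses.PrecisionLaplacian.InverseMCriticalKernel ↔
      (Summit.CriticalPhenomena.Ising3DConformalLimit.Theses.PrecisionLaplacian.InverseMFerromagnet →
        IsSymmetricPotential) :=
  Iff.rfl

/-- Transcription check: item 4803 is literally `IsSymmetricPotential → KernelForm`. -/
theorem precisionIsLaplacian_iff :
    Summit.CriticalPhenomena.Ising3DConformalLimit.Theses.PrecisionLaplacian.PrecisionIsLaplacian ↔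
      (IsSymmetricPotential → KernelForm) :=
  Iff.rfl

/-- `G` takes the same value on the six unit steps (coordinate permutations + evenness). -/
theorem G_unit {x : Site 3} (hx : ∃ i : Fin 3, x = Pi.single i 1 ∨ x = -Pi.single i 1) :
    G x = G (Pi.single 0 1) := by
  obtain ⟨i, rfl | rfl⟩ := hx
  · exact twoPointPlus_single_eq_single twoPointPlus_perm_invariant_holds (criticalBeta_nonneg 3) i 0 1
  · rw [show G (-Pi.single i 1) = G (Pi.single i 1) from criticalTwoPoint_neg _]
    exact twoPointPlus_single_eq_single twoPointPlus_perm_invariant_holds (criticalBeta_nonneg 3) i 0 1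

/-- Maximality re-centred at any unit step: `G(z) ≤ G(x)` for `z ≠ 0`, `x ∈ {±eᵢ}`. -/
theorem G_le_G_unit {x z : Site 3} (hx : ∃ i : Fin 3, x = Pi.single i 1 ∨ x = -Pi.single i 1)
    (hz : z ≠ 0) : G z ≤ G x := by
  rw [G_unit hx]
  exact unitRate_G_le_G_e0 hz

/-- The six unit steps `{±e₀, ±e₁, ±e₂}`. -/
def unitSteps : Finset (Site 3) :=
  (Finset.univ.image fun i : Fin 3 => (Pi.single i 1 : Site 3)) ∪
    Finset.univ.image fun i : Fin 3 => (-Pi.single i 1 : Site 3)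

/-- Membership in `unitSteps`: the six signed unit vectors. -/
theorem mem_unitSteps {y : Site 3} :
    y ∈ unitSteps ↔ ∃ i : Fin 3, y = Pi.single i 1 ∨ y = -Pi.single i 1 := by
  simp only [unitSteps, Finset.mem_union, Finset.mem_image, Finset.mem_univ, true_and]
  constructor
  · rintro (⟨i, hi⟩ | ⟨i, hi⟩)
    · exact ⟨i, Or.inl hi.symm⟩
    · exact ⟨i, Or.inr hi.symm⟩
  · rintro ⟨i, hi | hi⟩
    · exact Or.inl ⟨i, hi.symm⟩
    · exact Or.inr ⟨i, hi.symm⟩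

/-- `i ↦ eᵢ` is injective. -/
theorem single_injective : Function.Injective fun i : Fin 3 => (Pi.single i 1 : Site 3) := by
  intro i j h
  by_contra hij
  have h1 := congrFun h i
  simp only [Pi.single_eq_same, Pi.single_eq_of_ne hij] at h1
  exact one_ne_zero h1

/-- `eᵢ ≠ −eⱼ`. -/
theorem single_ne_neg_single (i j : Fin 3) : (Pi.single i 1 : Site 3) ≠ -Pi.single j 1 := by
  intro h
  have h1 := congrFun h i
  by_cases hij : i = j
  · subst hij
    simp only [Pi.single_eq_same, Pi.neg_apply] at h1
    omega
  · simp only [Pi.single_eq_same, Pi.neg_apply, Pi.single_eq_of_ne hij, neg_zero] at h1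
    exact one_ne_zero h1

/-- A sum over the six unit steps is the crux's `Σᵢ (φ(eᵢ) + φ(−eᵢ))`. -/
theorem sum_unitSteps (φ : Site 3 → ℝ) :
    ∑ y ∈ unitSteps, φ y = ∑ i : Fin 3, (φ (Pi.single i 1) + φ (-Pi.single i 1)) := by
  have hdisj : Disjoint (Finset.univ.image fun i : Fin 3 => (Pi.single i 1 : Site 3))
      (Finset.univ.image fun i : Fin 3 => (-Pi.single i 1 : Site 3)) := by
    rw [Finset.disjoint_left]
    intro y hy hy'
    rw [Finset.mem_image] at hy hy'
    obtain ⟨i, -, rfl⟩ := hy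
    obtain ⟨j, -, hj⟩ := hy'
    exact single_ne_neg_single i j hj.symm
  have hinj₁ : ∀ i ∈ (Finset.univ : Finset (Fin 3)), ∀ j ∈ (Finset.univ : Finset (Fin 3)),
      (Pi.single i 1 : Site 3) = Pi.single j 1 → i = j := fun i _ j _ h => single_injective h
  have hinj₂ : ∀ i ∈ (Finset.univ : Finset (Fin 3)), ∀ j ∈ (Finset.univ : Finset (Fin 3)),
      (-Pi.single i 1 : Site 3) = -Pi.single j 1 → i = j :=
    fun i _ j _ h => single_injective (neg_injective h)
  rw [unitSteps, Finset.sum_union hdisj, Finset.sum_image hinj₁, Finset.sum_image hinj₂,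
    ← Finset.sum_add_distrib]

/-- `y ↦ a(y)·G(x−y)` is absolutely summable (`|G| ≤ 1`). -/
theorem summable_dcf_mul (x : Site 3) (hs : Summable dcf) : Summable (fun y => dcf y * G (x - y)) := by
  have h1 : Summable (fun y => |dcf y * G (x - y)|) := by
    refine Summable.of_nonneg_of_le (fun y => abs_nonneg _) (fun y => ?_) hs.abs
    rw [abs_mul]
    refine mul_le_of_le_one_right (abs_nonneg _) (abs_le.2 ⟨?_, criticalTwoPoint_le_one' _⟩)
    linarith [criticalTwoPoint_nonneg' (x - y)]
  exact h1.of_abs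

/-- THE BALANCE (card L0, identity level, no slack): for `x ≠ 0`, `Σ_y a(y)·[G(x) − G(x−y)] = 0` as an
unconditional sum — `G` is harmonic off the origin for its own conservative precision Laplacian
(criticality: total mass `0`; source term only at `x = 0`, where the convolution is `−1`). -/
theorem hasSum_balance (hK : KernelForm) {x : Site 3} (hx : x ≠ 0) :
    HasSum (fun y => dcf y * (G x - G (x - y))) 0 := by
  obtain ⟨hs, hs0, -, -, hconv⟩ := hK
  have h1 : HasSum dcf 0 := hs.hasSum_iff.2 hs0
  have h2 : HasSum (fun y => dcf y * G (x - y)) 0 :=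
    (summable_dcf_mul x hs).hasSum_iff.2 ((hconv x).trans (if_neg hx))
  have h3 := (h1.mul_right (G x)).sub h2
  rw [zero_mul, sub_zero] at h3
  exact h3.congr_fun fun y => by ring

/-- Transport of a finite index set `A ⊂ ℤ³` under a lattice symmetry `φ`. -/
def imageEquiv (φ : Site 3 ≃ Site 3) (A : Finset (Site 3)) : ↥A ≃ ↥(A.image φ) where
  toFun p := ⟨φ p.1, Finset.mem_image_of_mem φ p.2⟩
  invFun q := ⟨φ.symm q.1, by
    obtain ⟨p, hp, hpq⟩ := Finset.mem_image.1 q.2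
    rw [← hpq, Equiv.symm_apply_apply]
    exact hp⟩
  left_inv p := Subtype.ext (φ.symm_apply_apply p.1)
  right_inv q := Subtype.ext (φ.apply_symm_apply q.1)

/-- The index families `{A ∋ 0, y}` and `{B ∋ 0, φ y}` of the infimum correspond under `A ↦ φ(A)`. -/
def idxEquiv (φ : Site 3 ≃ Site 3) (h0 : φ 0 = 0) (y : Site 3) :
    {A : Finset (Site 3) // (0 : Site 3) ∈ A ∧ y ∈ A} ≃
      {B : Finset (Site 3) // (0 : Site 3) ∈ B ∧ φ y ∈ B} where
  toFun A := ⟨A.1.image φ, Finset.mem_image.2 ⟨0, A.2.1, h0⟩, Finset.mem_image_of_mem φ A.2.2⟩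
  invFun B := ⟨B.1.image φ.symm, Finset.mem_image.2 ⟨0, B.2.1, φ.symm_apply_eq.2 h0.symm⟩,
    Finset.mem_image.2 ⟨φ y, B.2.2, φ.symm_apply_apply y⟩⟩
  left_inv A := Subtype.ext (by simp [Finset.image_image])
  right_inv B := Subtype.ext (by simp [Finset.image_image])

/-- Transport of the inverse two-point matrix: `(G_{φA})⁻¹(φa, φb) = (G_A)⁻¹(a, b)` for an additive
bijection `φ` leaving `G` invariant (`G_{φA} = reindex G_A`, `Matrix.inv_reindex`). -/
theorem inv_entry_image (φ : Site 3 ≃ Site 3)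
    (hadds : ∀ p q : Site 3, φ.symm (q - p) = φ.symm q - φ.symm p)
    (hGs : ∀ z : Site 3, G (φ.symm z) = G z) (A : Finset (Site 3)) (a b : ↥A) :
    (Matrix.of fun (p q : ↥(A.image φ)) => G (q.1 - p.1))⁻¹ (imageEquiv φ A a) (imageEquiv φ A b) =
      (Matrix.of fun (p q : ↥A) => G (q.1 - p.1))⁻¹ a b := by
  have hM : (Matrix.of fun (p q : ↥(A.image φ)) => G (q.1 - p.1)) =
      Matrix.reindex (imageEquiv φ A) (imageEquiv φ A) (Matrix.of fun (p q : ↥A) => G (q.1 - p.1)) := by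
    ext q q'
    simp only [Matrix.reindex_apply, Matrix.submatrix_apply, Matrix.of_apply]
    show G (q'.1 - q.1) = G (φ.symm q'.1 - φ.symm q.1)
    rw [← hadds, hGs]
  rw [hM, Matrix.inv_reindex, Matrix.reindex_apply, Matrix.submatrix_apply, Equiv.symm_apply_apply,
    Equiv.symm_apply_apply]

/-- **Equivariance of the canonical direct-correlation function**: `a(φ y) = a(y)` for every additive
bijection `φ` of `ℤ³` leaving `G` invariant (transport of structure: `G_{φA} = reindex G_A`, so
`(G_{φA})⁻¹(0, φy) = (G_A)⁻¹(0, y)` by `Matrix.inv_reindex`, and `A ↦ φ(A)` is a bijection of the index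
families). No inverse-M hypothesis is needed. -/
theorem dcf_equivariant (φ : Site 3 ≃ Site 3) (hadd : ∀ p q : Site 3, φ (q - p) = φ q - φ p)
    (hG : ∀ z : Site 3, G (φ z) = G z) (y : Site 3) : dcf (φ y) = dcf y := by
  have h0 : φ 0 = 0 := by simpa using hadd 0 0
  have hGs : ∀ z : Site 3, G (φ.symm z) = G z := fun z => by
    conv_rhs => rw [← φ.apply_symm_apply z]
    exact (hG _).symm
  have hadds : ∀ p q : Site 3, φ.symm (q - p) = φ.symm q - φ.symm p := fun p q =>
    φ.injective (by rw [hadd, φ.apply_symm_apply, φ.apply_symm_apply, φ.apply_symm_apply])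
  symm
  unfold dcf
  refine Equiv.iInf_congr (idxEquiv φ h0 y) fun A => ?_
  dsimp only [idxEquiv, Equiv.coe_fn_mk]
  have e1 : (⟨0, Finset.mem_image.2 ⟨0, A.2.1, h0⟩⟩ : ↥(A.1.image φ)) = imageEquiv φ A.1 ⟨0, A.2.1⟩ :=
    Subtype.ext h0.symm
  have e2 : (⟨φ y, Finset.mem_image_of_mem φ A.2.2⟩ : ↥(A.1.image φ)) = imageEquiv φ A.1 ⟨y, A.2.2⟩ :=
    Subtype.ext rfl
  rw [e1, e2, inv_entry_image φ hadds hGs]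

/-- The coordinate transposition `x ↦ x ∘ (i 0)` as a lattice symmetry. -/
def swapCoord (i : Fin 3) : Site 3 ≃ Site 3 where
  toFun x := fun j => x (Equiv.swap i 0 j)
  invFun x := fun j => x (Equiv.swap i 0 j)
  left_inv x := by funext j; simp [Equiv.swap_apply_self]
  right_inv x := by funext j; simp [Equiv.swap_apply_self]

/-- The transposition `(i 0)` sends `e₀` to `eᵢ`. -/
theorem swapCoord_single (i : Fin 3) : swapCoord i (Pi.single 0 1) = Pi.single i 1 := by
  funext j
  show (Pi.single (0 : Fin 3) (1 : ℤ) : Site 3) (Equiv.swap i 0 j) = (Pi.single i (1 : ℤ) : Site 3) j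
  by_cases hj : j = i
  · subst hj
    simp
  · rw [Pi.single_eq_of_ne hj]
    by_cases hj0 : j = 0
    · subst hj0
      rw [Equiv.swap_apply_right]
      exact Pi.single_eq_of_ne (Ne.symm hj) _
    · rw [Equiv.swap_apply_of_ne_of_ne hj hj0]
      exact Pi.single_eq_of_ne hj0 _

/-- `a(eᵢ) = a(e₀)` (coordinate permutation invariance of `G`, `twoPointPlus_perm_invariant_holds`). -/
theorem dcf_single (i : Fin 3) : dcf (Pi.single i 1) = dcf (Pi.single 0 1) := by
  rw [← swapCoord_single i]
  exact dcf_equivariant (swapCoord i) (fun p q => rfl)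
    (fun z => twoPointPlus_perm_invariant_holds (criticalBeta_nonneg 3) (Equiv.swap i 0) z) _

/-- `a(−y) = a(y)` (evenness of `G`, `criticalTwoPoint_neg`). -/
theorem dcf_neg (y : Site 3) : dcf (-y) = dcf y :=
  dcf_equivariant (Equiv.neg (Site 3)) (fun p q => by simp only [Equiv.neg_apply]; abel)
    (fun z => by simp only [Equiv.neg_apply]; exact criticalTwoPoint_neg z) y

/-- The kernel is the constant `a₁ = a(e₀)` on the six unit steps (PROVED; formerly half of `UnitRate`). -/
theorem dcf_unit_symm (i : Fin 3) :
    dcf (Pi.single i 1) = dcf (Pi.single 0 1) ∧ dcf (-Pi.single i 1) = dcf (Pi.single 0 1) :=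
  ⟨dcf_single i, (dcf_neg _).trans (dcf_single i)⟩

/-- On the six unit steps the kernel is the constant `a₁ = a(e₀)` (`UnitRate`'s symmetry conjunct), so
the unit-step part of the balance is `a₁ · (6·G(x) − N(x))`. -/
theorem sum_unitSteps_balance
    (hsym : ∀ i : Fin 3, dcf (Pi.single i 1) = dcf (Pi.single 0 1) ∧ dcf (-Pi.single i 1) = dcf (Pi.single 0 1))
    (x : Site 3) :
    ∑ y ∈ unitSteps, dcf y * (G x - G (x - y)) = dcf (Pi.single 0 1) * (6 * G x - nbrSum x) := by
  rw [sum_unitSteps (fun y => dcf y * (G x - G (x - y)))]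
  have hev : ∀ i : Fin 3,
      dcf (Pi.single i 1) * (G x - G (x - Pi.single i 1)) +
        dcf (-Pi.single i 1) * (G x - G (x - -Pi.single i 1)) =
      dcf (Pi.single 0 1) * (2 * G x - (G (x + Pi.single i 1) + G (x - Pi.single i 1))) := by
    intro i
    rw [(hsym i).1, (hsym i).2, sub_neg_eq_add]
    ring
  rw [Finset.sum_congr rfl fun i _ => hev i, ← Finset.mul_sum]
  congr 1
  simp only [nbrSum, Fin.sum_univ_three]
  ring

/-- **Card identity L0 (proved): the lattice Laplacian IS the long-range part of the precision kernel
acting on `G`.** For `x ≠ 0`, `a₁ · (N(x) − 6·G(x)) = Σ_{y ∉ {±eᵢ}} a(y)·[G(x) − G(x−y)]` as an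
unconditional sum (the `y = 0` term vanishes; no sign is claimed here — beyond the first shell the terms
have both signs, triage r1-1 (iv)). This is the exact reduction of SubH at any site to precision entries
and short-distance values of `G` that the card's items (3)(c) and the cheapest falsifier refer to. -/
theorem longJump_identity (hK : KernelForm)
    (hsym : ∀ i : Fin 3, dcf (Pi.single i 1) = dcf (Pi.single 0 1) ∧ dcf (-Pi.single i 1) = dcf (Pi.single 0 1))
    {x : Site 3} (hx : x ≠ 0) :
    HasSum (fun y => if y ∈ unitSteps then 0 else dcf y * (G x - G (x - y)))
      (dcf (Pi.single 0 1) * (nbrSum x - 6 * G x)) := by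
  have hbal := hasSum_balance hK hx
  have hfin : HasSum (fun y => if y ∈ unitSteps then dcf y * (G x - G (x - y)) else 0)
      (∑ y ∈ unitSteps, if y ∈ unitSteps then dcf y * (G x - G (x - y)) else 0) :=
    hasSum_sum_of_ne_finset_zero fun y hy => if_neg hy
  rw [Finset.sum_congr rfl fun y hy => if_pos hy, sum_unitSteps_balance hsym x] at hfin
  have hrest := hbal.sub hfin
  rw [show (0 : ℝ) - dcf (Pi.single 0 1) * (6 * G x - nbrSum x) =
      dcf (Pi.single 0 1) * (nbrSum x - 6 * G x) by ring] at hrest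
  refine hrest.congr_fun fun y => ?_
  by_cases hy : y ∈ unitSteps <;> simp [hy]

/-- **First shell.** Under the kernel form of item 4803 and `UnitRate`'s two conclusions, SubH holds at
every unit step `x = ±eᵢ`: in the balance `Σ_y a(y)[G(x) − G(x−y)] = 0` every term with
`y ∉ {±eⱼ}` is `≥ 0` (`a(y) ≥ 0`, `G(x−y) ≤ G(x)` by maximality since `x − y ≠ 0`; the `y = 0` term
vanishes), so the six unit-step terms sum to `≤ 0`, i.e. `a₁·(6G(x) − N(x)) ≤ 0` with `a₁ > 0`. -/
theorem firstShell (hK : KernelForm)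
    (hsym : ∀ i : Fin 3, dcf (Pi.single i 1) = dcf (Pi.single 0 1) ∧ dcf (-Pi.single i 1) = dcf (Pi.single 0 1))
    (ha : 0 < dcf (Pi.single 0 1)) {x : Site 3} (hxU : ∃ i : Fin 3, x = Pi.single i 1 ∨ x = -Pi.single i 1) :
    6 * G x ≤ nbrSum x := by
  have hx0 : x ≠ 0 := by
    obtain ⟨i, rfl | rfl⟩ := hxU
    · intro h
      have h1 := congrFun h i
      simp at h1
    · intro h
      have h1 := congrFun h i
      simp at h1
  have hbal := hasSum_balance hK hx0
  -- nonnegativity of the balance terms off the six unit steps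
  have hnn : ∀ y ∉ unitSteps, 0 ≤ dcf y * (G x - G (x - y)) := by
    intro y hy
    by_cases hy0 : y = 0
    · subst hy0
      simp
    · have hyx : x - y ≠ 0 := by
        intro h
        rw [sub_eq_zero] at h
        subst h
        exact hy (mem_unitSteps.2 hxU)
      exact mul_nonneg (hK.2.2.1 y hy0) (sub_nonneg.2 (G_le_G_unit hxU hyx))
  -- the six unit-step terms therefore sum to ≤ 0, and they sum to `a₁ · (6 G x − N x)` with `a₁ > 0`
  have hle := sum_le_hasSum unitSteps hnn hbal
  rw [sum_unitSteps_balance hsym x] at hle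
  nlinarith

/-- **THE REACH OF THE LEVER (registered sub-goal `subH_unitSteps_of_IM` of stmt-CriticalPhenomena-1341).**
IM (item 4798) + the kernel form (item 4803) + positivity of the nearest-neighbour direct correlation
(`stub_unitRate` of the line, as a hypothesis) give SubH at the six nearest neighbours — the numerically
thinnest sites of the crux — with no partner. -/
theorem subH_unitSteps_of_IM :
    Summit.CriticalPhenomena.Ising3DConformalLimit.Theses.PrecisionLaplacian.InverseMFerromagnet →
    Summit.CriticalPhenomena.Ising3DConformalLimit.Theses.PrecisionLaplacian.PrecisionIsLaplacian →
    (Summit.CriticalPhenomena.Ising3DConformalLimit.Theses.PrecisionLaplacian.InverseMFerromagnet →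
      0 < dcf (Pi.single 0 1)) →
    ∀ x : Site 3, (∃ i : Fin 3, x = Pi.single i 1 ∨ x = -Pi.single i 1) →
      6 * criticalTwoPoint 3 x ≤ nbrSum x := by
  intro hIM hPIL hU x hxU
  have hK : KernelForm :=
    (precisionIsLaplacian_iff.1 hPIL)
      ((inverseMCriticalKernel_iff.1
        Summit.CriticalPhenomena.Ising3DConformalLimit.Theorems.InverseMCriticalKernel_proof) hIM)
  exact firstShell hK dcf_unit_symm (hU hIM) hxU

/-- **IM ∧ PrecisionIsLaplacian ⇒ SubH at the six unit sites** (registered sub-goal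
`subH_unitSteps_of_IM_of_PIL`): `subH_unitSteps_of_IM` with the unit rate supplied by the landed
`DcsUnitRate.stub_unitRate` (`dcf e₀` is by definition the registered infimum). -/
theorem subH_unitSteps_of_IM_of_PIL :
    Summit.CriticalPhenomena.Ising3DConformalLimit.Theses.PrecisionLaplacian.InverseMFerromagnet →
    Summit.CriticalPhenomena.Ising3DConformalLimit.Theses.PrecisionLaplacian.PrecisionIsLaplacian →
    ∀ x : Site 3, (∃ i : Fin 3, x = Pi.single i 1 ∨ x = -Pi.single i 1) →
      6 * criticalTwoPoint 3 x ≤ nbrSum x :=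
  fun hIM hPIL => subH_unitSteps_of_IM hIM hPIL stub_unitRate

/-- The same with the crux's neighbour sum written out. -/
theorem subH_unitSteps_of_IM_of_PIL' :
    Summit.CriticalPhenomena.Ising3DConformalLimit.Theses.PrecisionLaplacian.InverseMFerromagnet →
    Summit.CriticalPhenomena.Ising3DConformalLimit.Theses.PrecisionLaplacian.PrecisionIsLaplacian →
    ∀ x : Site 3, (∃ i : Fin 3, x = Pi.single i 1 ∨ x = -Pi.single i 1) →
      6 * criticalTwoPoint 3 x ≤
        ∑ i : Fin 3, (criticalTwoPoint 3 (x + Pi.single i 1) + criticalTwoPoint 3 (x - Pi.single i 1)) :=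
  fun hIM hPIL x hx => by simpa [nbrSum] using subH_unitSteps_of_IM_of_PIL hIM hPIL x hx

/-- CROSS-ROUTE KILL (contrapositive): a violation of SubH at a unit step — e.g. a Monte-Carlo
`G(2,0,0) + 4·G(1,1,0) + 1 < 6·G(1,0,0)` at `β_c(3)` (measured margin `+0.0138`, cdisprove §(f)) —
refutes `InverseMFerromagnet ∧ PrecisionIsLaplacian` for the critical `ℤ³` Ising kernel. -/
theorem not_inverseM_and_PIL_of_unitStep_violation {x : Site 3}
    (hxU : ∃ i : Fin 3, x = Pi.single i 1 ∨ x = -Pi.single i 1)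
    (hlt : nbrSum x < 6 * criticalTwoPoint 3 x) :
    ¬ (Summit.CriticalPhenomena.Ising3DConformalLimit.Theses.PrecisionLaplacian.InverseMFerromagnet ∧
        Summit.CriticalPhenomena.Ising3DConformalLimit.Theses.PrecisionLaplacian.PrecisionIsLaplacian) :=
  fun h => absurd (subH_unitSteps_of_IM_of_PIL h.1 h.2 x hxU) (not_le.2 hlt)

end Summit.CriticalPhenomena.Ising3DConformalLimit.Theorems.PerfectScreening.Dcs

end
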